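import Mathlib
import Literature.Analysis.FluidPDE.SuitableWeak
import Literature.Analysis.FluidPDE.Seregin2023.TypeIIEulerZoom
import Summits.NavierStokesRegularity.NavierStokesRegularity.Theses.EulerZoomLiouville
import Summits.NavierStokesRegularity.NavierStokesRegularity.Theorems.EulerZoomLiouvillePowerGaugeEulerLiouvilleAxisymDSS
import HarnessLib

/-!
# The axisymmetric DSS strata of the crux `EulerZoomLiouville.PowerGaugeEulerLiouville` with
# `ω_θ/r ∈ L^{2m}` for ONE `m ≥ 1` (route №10, item stmt-NavierStokesRegularity-19832) — every `ρ > 0`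

Helper file (theorems only; `--supports stmt-NavierStokesRegularity-19832`). Seat ns-typeII-p3 (cell
ns-regularity-ideate §B, D-0081). Sequel of `…AxisymNoSwirlDSS.lean` / `…AxisymDSS.lean`: the `L²`
hypothesis on `η = ω_θ/r` is replaced by `η^m ∈ L²` (i.e. `η ∈ L^{2m}`) for one natural `m ≥ 1` — larger
`m` asks LESS decay of the vorticity profile at infinity (`|η| ≲ |y|^{−3/(2m) − ε}` suffices). The powers
`η^m` are again transported (`timeDerivWithin_angVortQuot_pow_eq_neg`), `∫ η^{2m}` is conserved
(`integral_angVortQuot_pow_sq_eq_of_classical`, via the abstract `integral_sq_eq_of_transport`), and the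
class scaling multiplies it by `l^{2m(3+ρ) − 3} > 1` (`integral_angVortQuot_pow_sq_smul_comp_smul`,
`angVortQuot_scaling_factor_eq`). Also recorded: the assembly lemma
`ae_eq_zero_of_gauge_of_curl_slice_eq_zero` (classical member of the class with curl-free slices
vanishes — `A`-gauge only), so that any future mechanism proving `curl u(τ) ≡ 0` plugs in.

* `powerGaugeEulerLiouville_axisym_dss_pow` — crux VERBATIM + classical + axisymmetric slices + DSS
  (`l > 1`) + bounded `u`/`∇u` + `(r u_θ)^k ∈ L²` (one `k ≥ 1`, `2kρ ≠ 3`) + `(ω_θ/r)^m ∈ L²` (one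
  `m ≥ 1`) on compact time intervals ⇒ `u = 0` a.e.;
* `powerGaugeEulerLiouville_axisymNoSwirl_dss_pow` — swirl-free version (no `k`).

WHAT THIS IS NOT: not NS, not the crux E — conditional strata (smooth = the tree's `IsClassicalNSSolutionOn`,
jointly `C^∞` on the open slab). [folklore]
-/

noncomputable section

-- the summit and its single problem share the name `NavierStokesRegularity` (D-0017 nested layout)
set_option linter.dupNamespace false

open Set Function Filter Topology MeasureTheory Metric Module
open scoped NNReal ENNReal InnerProductSpace RealInnerProductSpace

namespace Summit.NavierStokesRegularity.NavierStokesRegularity.Theorems.PowerGaugeEulerLiouville.AxisymNoSwirl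

open Literature.Analysis Literature.Analysis.FluidPDE
open Summit.NavierStokesRegularity.NavierStokesRegularity.Theorems.PowerGaugeEulerLiouville

/-! ## Assembly: curl-free classical slices ⇒ the member vanishes -/

/-- **A classical member of the power-gauged class all of whose slices are CURL-FREE vanishes a.e.**
(`ρ > −1`; only the `A`-gauge and `div u = 0` are used: each slice by `slice_ae_eq_zero_of_curl_eq_zero`,
then Tonelli on the slab). [folklore] -/
theorem ae_eq_zero_of_gauge_of_curl_slice_eq_zero {ρ : ℝ} (hρ : -1 < ρ)
    {u : ℝ → (EuclideanSpace ℝ (Fin 3)) → (EuclideanSpace ℝ (Fin 3))} {p : ℝ → (EuclideanSpace ℝ (Fin 3)) → ℝ}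
    {H : ℝ → (EuclideanSpace ℝ (Fin 3)) → (EuclideanSpace ℝ (Fin 3)) →L[ℝ] (EuclideanSpace ℝ (Fin 3))} {c : ℝ≥0}
    (hH : HasWeakSpatialGradientOn (slab (EuclideanSpace ℝ (Fin 3)) (Iio 0) isOpen_Iio) u H)
    (hc : ∀ a : ℝ, 0 < a → ENNReal.ofReal (a ^ (2 * ρ)) * cknA a (0 : ℝ × (EuclideanSpace ℝ (Fin 3))) u +
        ENNReal.ofReal (a ^ ρ) * cknE a (0 : ℝ × (EuclideanSpace ℝ (Fin 3))) H +
        ENNReal.ofReal (a ^ (2 * ρ)) * cknD a (0 : ℝ × (EuclideanSpace ℝ (Fin 3))) p ≤ (c : ℝ≥0∞))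
    (hns : IsClassicalNSSolutionOn (Iio 0) 0 0 u p)
    (hcurl : ∀ τ : ℝ, τ < 0 → ∀ x, curl (u τ) x = 0) :
    uncurry u =ᵐ[volume.restrict (Iio (0 : ℝ) ×ˢ (univ : Set (EuclideanSpace ℝ (Fin 3))))] 0 := by
  have hA := hasScaledLocalEnergyBound_of_gauge hc
  have hslice : ∀ τ : ℝ, τ < 0 → u τ =ᵐ[volume] 0 := by
    intro τ hτ
    have hu1 : ContDiff ℝ 1 (u τ) := (hns.contDiff_velocity hτ).of_le (by norm_cast)
    refine slice_ae_eq_zero_of_curl_eq_zero (ρ := ρ) hρ hu1 (hns.divFree τ hτ) (hcurl τ hτ)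
      (c := (c : ℝ)) (r₀ := Real.sqrt (-τ)) fun r hr hr0 => ?_
    have hs : τ ∈ Ioo (-(r ^ 2)) 0 := by
      refine ⟨?_, hτ⟩
      have h4 : Real.sqrt (-τ) ^ 2 = -τ := Real.sq_sqrt (by linarith)
      nlinarith [Real.sqrt_nonneg (-τ)]
    exact hA r hr0 τ hs
  have hmeas : AEStronglyMeasurable (uncurry u)
      (volume.restrict (Iio (0 : ℝ) ×ˢ (univ : Set (EuclideanSpace ℝ (Fin 3))))) := by
    have := hH.locallyIntegrableOn.aestronglyMeasurable
    simpa [slab] using this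
  have hint : ∫⁻ z in Iio (0 : ℝ) ×ˢ (univ : Set (EuclideanSpace ℝ (Fin 3))), ‖uncurry u z‖ₑ = 0 := by
    have hm := hmeas.aemeasurable.enorm
    rw [Measure.volume_eq_prod, ← Measure.restrict_prod_eq_prod_univ] at hm ⊢
    rw [lintegral_prod _ hm]
    have ht0 : ∀ᵐ t ∂(volume.restrict (Iio (0 : ℝ))), t < 0 := by
      rw [ae_restrict_iff' measurableSet_Iio]; exact Eventually.of_forall fun t ht => ht
    have hzero : (fun t : ℝ => ∫⁻ y, ‖uncurry u (t, y)‖ₑ) =ᵐ[volume.restrict (Iio 0)] 0 := by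
      filter_upwards [ht0] with t ht
      have : (fun y => ‖uncurry u (t, y)‖ₑ) =ᵐ[volume] fun _ => 0 := by
        filter_upwards [hslice t ht] with y hy
        simp [uncurry, hy]
      rw [lintegral_congr_ae this]
      simp
    rw [lintegral_congr_ae hzero]
    simp
  have hae := (lintegral_eq_zero_iff' hmeas.aemeasurable.enorm).1 hint
  filter_upwards [hae] with z hz
  simpa using hz

/-! ## The powers `η^m` are transported -/

/-- The powers `η^m` of `η = angVortQuot` along a jointly smooth field on `[0, T]` (`T > 0`) form a
jointly smooth family. [folklore] -/
theorem isSmoothSpaceTimeOn_angVortQuot_pow {T : ℝ} (hT : 0 < T)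
    {v : ℝ → (EuclideanSpace ℝ (Fin 3)) → (EuclideanSpace ℝ (Fin 3))} (h : IsSmoothSpaceTimeOn (Icc 0 T) v)
    (m : ℕ) : IsSmoothSpaceTimeOn (Icc 0 T) (fun s y => angVortQuot (v s) y ^ m) := by
  have h1 : IsSmoothSpaceTimeOn (Icc 0 T) (fun s => angVortQuot (v s)) :=
    h.angVortQuot_family (convex_Icc 0 T) (uniqueDiffOn_Icc hT)
  have h2 : uncurry (fun s (y : EuclideanSpace ℝ (Fin 3)) => angVortQuot (v s) y ^ m) =
      fun z => uncurry (fun s => angVortQuot (v s)) z ^ m := rfl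
  unfold IsSmoothSpaceTimeOn
  rw [h2]
  exact h1.pow m

/-- **`∂ₜ(η^m) = −D(η^m)[u]`** along a classical swirl-free axisymmetric Euler flow on `[0, T]` (chain
rule on `timeDerivWithin_angVortQuot_eq_neg`). [folklore] -/
theorem timeDerivWithin_angVortQuot_pow_eq_neg {T : ℝ} (hT : 0 < T)
    {v : ℝ → (EuclideanSpace ℝ (Fin 3)) → (EuclideanSpace ℝ (Fin 3))} {q : ℝ → (EuclideanSpace ℝ (Fin 3)) → ℝ}
    (hv : IsClassicalNSSolutionOn (Icc 0 T) 0 0 v q)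
    (hax : ∀ σ ∈ Icc 0 T, IsAxisymmetric (v σ)) (hsw : ∀ σ ∈ Icc 0 T, HasNoSwirl (v σ))
    (m : ℕ) {σ : ℝ} (hσ : σ ∈ Icc 0 T) (x : (EuclideanSpace ℝ (Fin 3))) :
    FluidPDE.timeDerivWithin (Icc 0 T) (fun s y => angVortQuot (v s) y ^ m) σ x =
      -(fderiv ℝ (fun y => angVortQuot (v σ) y ^ m) x (v σ x)) := by
  have hS : UniqueDiffOn ℝ (Icc 0 T) := uniqueDiffOn_Icc hT
  have hfam : IsSmoothSpaceTimeOn (Icc 0 T) (fun s => angVortQuot (v s)) :=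
    hv.smooth_velocity.angVortQuot_family (convex_Icc 0 T) hS
  have hηt : HasDerivWithinAt (fun s => angVortQuot (v s) x)
      (FluidPDE.timeDerivWithin (Icc 0 T) (fun s => angVortQuot (v s)) σ x) (Icc 0 T) σ :=
    hfam.hasDerivWithinAt_timeDerivWithin hS hσ x
  have hv4 : ContDiff ℝ 4 (v σ) := (hv.contDiff_velocity hσ).of_le (by norm_cast)
  have hη1 : ContDiff ℝ 1 (angVortQuot (v σ)) := contDiff_angVortQuot (n := 1) hv4
  have hηx : DifferentiableAt ℝ (angVortQuot (v σ)) x := (hη1.differentiable one_ne_zero) x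
  have ht : FluidPDE.timeDerivWithin (Icc 0 T) (fun s y => angVortQuot (v s) y ^ m) σ x =
      (m : ℝ) * angVortQuot (v σ) x ^ (m - 1) *
        FluidPDE.timeDerivWithin (Icc 0 T) (fun s => angVortQuot (v s)) σ x := by
    rw [timeDerivWithin_apply, (hηt.fun_pow m).derivWithin (hS σ hσ)]
  have hx : fderiv ℝ (fun y => angVortQuot (v σ) y ^ m) x (v σ x) =
      (m : ℝ) * angVortQuot (v σ) x ^ (m - 1) * fderiv ℝ (angVortQuot (v σ)) x (v σ x) := by
    rw [show (fun y => angVortQuot (v σ) y ^ m) = angVortQuot (v σ) ^ m from rfl, fderiv_pow _ hηx]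
    simp [smul_eq_mul]
  rw [ht, hx, timeDerivWithin_angVortQuot_eq_neg hT hv hax hsw hσ x]
  ring

/-- **Conservation of `∫ (ω_θ/r)^{2m}` along a classical axisymmetric swirl-free Euler flow on `(−∞,0)`**
under the cut-off hypotheses on `[s, t]` (bounded `u`, `∇u`; `η^m ∈ L²` with a uniform bound). [folklore] -/
theorem integral_angVortQuot_pow_sq_eq_of_classical
    {u : ℝ → (EuclideanSpace ℝ (Fin 3)) → (EuclideanSpace ℝ (Fin 3))} {p : ℝ → (EuclideanSpace ℝ (Fin 3)) → ℝ}
    (hns : IsClassicalNSSolutionOn (Iio 0) 0 0 u p)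
    (hax : ∀ τ : ℝ, τ < 0 → IsAxisymmetric (u τ)) (hsw : ∀ τ : ℝ, τ < 0 → HasNoSwirl (u τ)) (m : ℕ)
    {s t : ℝ} (hst : s < t) (ht : t < 0)
    {B : ℝ} (hB : ∀ τ ∈ Icc s t, ∀ y, ‖u τ y‖ ≤ B ∧ ‖fderiv ℝ (u τ) y‖ ≤ B)
    {N : ℝ} (hN : ∀ τ ∈ Icc s t, Integrable (fun y => (angVortQuot (u τ) y ^ m) ^ 2) ∧
      ∫ y, (angVortQuot (u τ) y ^ m) ^ 2 ≤ N) :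
    ∫ y, (angVortQuot (u t) y ^ m) ^ 2 = ∫ y, (angVortQuot (u s) y ^ m) ^ 2 := by
  set T : ℝ := t - s with hTdef
  have hT : 0 < T := sub_pos.2 hst
  have hsub : Icc 0 T ⊆ (fun σ : ℝ => σ + s) ⁻¹' Iio (0 : ℝ) := by
    intro σ hσ
    show σ + s < 0
    have := hσ.2; rw [hTdef] at this; linarith
  have hmem : ∀ σ ∈ Icc 0 T, σ + s ∈ Icc s t := fun σ hσ =>
    ⟨by linarith [hσ.1], by have := hσ.2; rw [hTdef] at this; linarith⟩
  have hv : IsClassicalNSSolutionOn (Icc 0 T) 0 0 (fun σ => u (σ + s)) (fun σ => p (σ + s)) :=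
    (hns.comp_add_right s).mono hsub (uniqueDiffOn_Icc hT)
  have haxv : ∀ σ ∈ Icc 0 T, IsAxisymmetric (u (σ + s)) := fun σ hσ => hax (σ + s) (hsub hσ)
  have hswv : ∀ σ ∈ Icc 0 T, HasNoSwirl (u (σ + s)) := fun σ hσ => hsw (σ + s) (hsub hσ)
  have h := integral_sq_eq_of_transport hT (W := fun σ y => angVortQuot (u (σ + s)) y ^ m)
    (isSmoothSpaceTimeOn_angVortQuot_pow hT hv.smooth_velocity m)
    (fun σ hσ => (hv.contDiff_velocity hσ).of_le (by norm_cast)) (fun σ hσ => hv.divFree σ hσ)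
    (fun σ hσ x => timeDerivWithin_angVortQuot_pow_eq_neg hT hv haxv hswv m hσ x)
    (fun σ hσ => hB (σ + s) (hmem σ hσ)) (fun σ hσ => hN (σ + s) (hmem σ hσ))
  simp only [hTdef, sub_add_cancel, zero_add] at h
  exact h

/-! ## Scaling of `∫ η^{2m}` and the exponent mismatch -/

/-- **`∫ (η_w^m)² = (cλ²)^{2m} λ⁻³ ∫ (η_v^m)²`** for `w = c • v(λ ·)`, `λ > 0`, `v ∈ C³` axisymmetric. [folklore] -/
theorem integral_angVortQuot_pow_sq_smul_comp_smul {v : (EuclideanSpace ℝ (Fin 3)) → (EuclideanSpace ℝ (Fin 3))}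
    (hax : IsAxisymmetric v) (hv : ContDiff ℝ 3 v) (c : ℝ) {lam : ℝ} (hlam : 0 < lam) (m : ℕ) :
    ∫ y, (angVortQuot (fun z : (EuclideanSpace ℝ (Fin 3)) => c • v (lam • z)) y ^ m) ^ 2 =
      (c * lam ^ 2) ^ (2 * m) * (lam ^ 3)⁻¹ * ∫ y, (angVortQuot v y ^ m) ^ 2 := by
  rw [angVortQuot_smul_comp_smul hax hv c lam]
  have h1 : (fun y : (EuclideanSpace ℝ (Fin 3)) => ((c * lam ^ 2 * angVortQuot v (lam • y)) ^ m) ^ 2) =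
      fun y => (c * lam ^ 2) ^ (2 * m) * (fun z : (EuclideanSpace ℝ (Fin 3)) => (angVortQuot v z ^ m) ^ 2) (lam • y) := by
    funext y; ring
  rw [h1, integral_const_mul, Measure.integral_comp_smul volume
      (fun z : (EuclideanSpace ℝ (Fin 3)) => (angVortQuot v z ^ m) ^ 2) lam,
    finrank_euclideanSpace_fin, abs_of_pos (inv_pos.2 (pow_pos hlam 3)), smul_eq_mul]
  ring

/-- The scaling factor of `∫ η^{2m}` under the class scaling: `(l^{1+ρ} l²)^{2m} (l³)⁻¹ = l^{2m(3+ρ) − 3}`.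
[folklore] -/
theorem angVortQuot_scaling_factor_eq {l ρ : ℝ} (hl : 0 < l) (m : ℕ) :
    (l ^ (1 + ρ) * l ^ (2 : ℕ)) ^ (2 * m) * (l ^ (3 : ℕ))⁻¹ = l ^ (2 * (m : ℝ) * (3 + ρ) - 3) := by
  have h1 : l ^ (1 + ρ) * l ^ (2 : ℕ) = l ^ (3 + ρ) := by
    rw [← Real.rpow_natCast l 2, ← Real.rpow_add hl]; push_cast; ring_nf
  rw [h1, ← Real.rpow_natCast (l ^ (3 + ρ)), ← Real.rpow_mul hl.le, ← Real.rpow_natCast l 3,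
    ← Real.rpow_neg hl.le, ← Real.rpow_add hl]
  congr 1
  push_cast
  ring

/-- **`∫ η(τ)^{2m} = 0` for a DSS axisymmetric swirl-free classical Euler flow** (`m ≥ 1`): the class
scaling multiplies `∫ η^{2m}` by `l^{2m(3+ρ)−3} > 1`, transport conserves it. [folklore] -/
theorem integral_angVortQuot_pow_sq_eq_zero_of_dss {ρ : ℝ} (hρ : 0 < ρ)
    {u : ℝ → (EuclideanSpace ℝ (Fin 3)) → (EuclideanSpace ℝ (Fin 3))} {p : ℝ → (EuclideanSpace ℝ (Fin 3)) → ℝ}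
    (hns : IsClassicalNSSolutionOn (Iio 0) 0 0 u p)
    (hax : ∀ τ : ℝ, τ < 0 → IsAxisymmetric (u τ)) (hsw : ∀ τ : ℝ, τ < 0 → HasNoSwirl (u τ))
    {l : ℝ} (hl : 1 < l)
    (hdss : ∀ τ : ℝ, τ < 0 → ∀ y, u τ y = (l ^ (1 + ρ)) • u ((l ^ (2 + ρ)) * τ) (l • y))
    (hbdd : ∀ s t : ℝ, s < t → t < 0 → ∃ B : ℝ, ∀ τ ∈ Icc s t, ∀ y,
      ‖u τ y‖ ≤ B ∧ ‖fderiv ℝ (u τ) y‖ ≤ B)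
    {m : ℕ} (hm : 1 ≤ m)
    (hLm : ∀ s t : ℝ, s < t → t < 0 → ∃ N : ℝ, ∀ τ ∈ Icc s t,
      Integrable (fun y => (angVortQuot (u τ) y ^ m) ^ 2) ∧ ∫ y, (angVortQuot (u τ) y ^ m) ^ 2 ≤ N)
    {τ : ℝ} (hτ : τ < 0) : ∫ y, (angVortQuot (u τ) y ^ m) ^ 2 = 0 := by
  have hl0 : 0 < l := zero_lt_one.trans hl
  have hL : 1 < l ^ (2 + ρ) := Real.one_lt_rpow hl (by linarith)
  set τ' : ℝ := l ^ (2 + ρ) * τ with hτ'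
  have hτ'τ : τ' < τ := by
    have : τ' - τ = (l ^ (2 + ρ) - 1) * τ := by rw [hτ']; ring
    nlinarith
  have hτ'0 : τ' < 0 := hτ'τ.trans hτ
  have hfun : u τ = fun y => (l ^ (1 + ρ)) • u τ' (l • y) := funext fun y => hdss τ hτ y
  have hu3 : ContDiff ℝ 3 (u τ') := (hns.contDiff_velocity hτ'0).of_le (by norm_cast)
  have hscale : ∫ y, (angVortQuot (u τ) y ^ m) ^ 2 =
      l ^ (2 * (m : ℝ) * (3 + ρ) - 3) * ∫ y, (angVortQuot (u τ') y ^ m) ^ 2 := by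
    rw [hfun, integral_angVortQuot_pow_sq_smul_comp_smul (hax τ' hτ'0) hu3 _ hl0 m,
      angVortQuot_scaling_factor_eq hl0 m]
  obtain ⟨B, hB⟩ := hbdd τ' τ hτ'τ hτ
  obtain ⟨N, hN⟩ := hLm τ' τ hτ'τ hτ
  have hcons := integral_angVortQuot_pow_sq_eq_of_classical hns hax hsw m hτ'τ hτ hB hN
  rw [hcons] at hscale
  have hexp : 0 < 2 * (m : ℝ) * (3 + ρ) - 3 := by
    have : (1 : ℝ) ≤ m := by exact_mod_cast hm
    nlinarith
  have hM : 1 < l ^ (2 * (m : ℝ) * (3 + ρ) - 3) := Real.one_lt_rpow hl hexp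
  have hnn : 0 ≤ ∫ y, (angVortQuot (u τ') y ^ m) ^ 2 := integral_nonneg fun y => sq_nonneg _
  have hI : ∫ y, (angVortQuot (u τ') y ^ m) ^ 2 = 0 := by nlinarith
  rw [hcons, hI]

/-- **Every slice of a DSS axisymmetric swirl-free classical member with `η^m ∈ L²` is irrotational.**
[folklore] -/
theorem curl_slice_eq_zero_of_dss_pow {ρ : ℝ} (hρ : 0 < ρ)
    {u : ℝ → (EuclideanSpace ℝ (Fin 3)) → (EuclideanSpace ℝ (Fin 3))} {p : ℝ → (EuclideanSpace ℝ (Fin 3)) → ℝ}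
    (hns : IsClassicalNSSolutionOn (Iio 0) 0 0 u p)
    (hax : ∀ τ : ℝ, τ < 0 → IsAxisymmetric (u τ)) (hsw : ∀ τ : ℝ, τ < 0 → HasNoSwirl (u τ))
    {l : ℝ} (hl : 1 < l)
    (hdss : ∀ τ : ℝ, τ < 0 → ∀ y, u τ y = (l ^ (1 + ρ)) • u ((l ^ (2 + ρ)) * τ) (l • y))
    (hbdd : ∀ s t : ℝ, s < t → t < 0 → ∃ B : ℝ, ∀ τ ∈ Icc s t, ∀ y,
      ‖u τ y‖ ≤ B ∧ ‖fderiv ℝ (u τ) y‖ ≤ B)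
    {m : ℕ} (hm : 1 ≤ m)
    (hLm : ∀ s t : ℝ, s < t → t < 0 → ∃ N : ℝ, ∀ τ ∈ Icc s t,
      Integrable (fun y => (angVortQuot (u τ) y ^ m) ^ 2) ∧ ∫ y, (angVortQuot (u τ) y ^ m) ^ 2 ≤ N)
    {τ : ℝ} (hτ : τ < 0) (x : (EuclideanSpace ℝ (Fin 3))) : curl (u τ) x = 0 := by
  have h0 := integral_angVortQuot_pow_sq_eq_zero_of_dss hρ hns hax hsw hl hdss hbdd hm hLm hτ
  have hu3 : ContDiff ℝ 3 (u τ) := (hns.contDiff_velocity hτ).of_le (by norm_cast)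
  have hcont : Continuous (fun y => (angVortQuot (u τ) y ^ m) ^ 2) :=
    ((contDiff_angVortQuot (n := 0) hu3).continuous.pow m).pow 2
  obtain ⟨N, hN⟩ := hLm (2 * τ) τ (by linarith) hτ
  have hint : Integrable (fun y => (angVortQuot (u τ) y ^ m) ^ 2) := (hN τ ⟨by linarith, le_rfl⟩).1
  have hae : (fun y => (angVortQuot (u τ) y ^ m) ^ 2) =ᵐ[volume] 0 :=
    (integral_eq_zero_iff_of_nonneg (fun y => sq_nonneg _) hint).1 h0
  have hzero : (fun y => (angVortQuot (u τ) y ^ m) ^ 2) = 0 :=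
    Continuous.ae_eq_iff_eq volume hcont continuous_const |>.1 hae
  have hm0 : m ≠ 0 := by omega
  have hΩ : ∀ y, angVortQuot (u τ) y = 0 := fun y => by
    have := congrFun hzero y
    simpa [hm0] using this
  exact curl_eq_zero_of_angVortQuot_eq_zero (hax τ hτ) (hsw τ hτ) hu3 hΩ x

/-! ## The strata with one exponent each -/

/-- **The axisymmetric swirl-free DSS stratum with `ω_θ/r ∈ L^{2m}`** (one `m ≥ 1`; every `ρ > 0`).
[folklore] -/
theorem powerGaugeEulerLiouville_axisymNoSwirl_dss_pow :
    ∀ ρ : ℝ, 0 < ρ → ∀ (u : ℝ → EuclideanSpace ℝ (Fin 3) → EuclideanSpace ℝ (Fin 3))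
      (p : ℝ → EuclideanSpace ℝ (Fin 3) → ℝ)
      (H : ℝ → EuclideanSpace ℝ (Fin 3) → EuclideanSpace ℝ (Fin 3) →L[ℝ] EuclideanSpace ℝ (Fin 3)) (c : ℝ≥0)
      (l : ℝ) (m : ℕ),
      IsSuitableWeakSolutionOn (slab (EuclideanSpace ℝ (Fin 3)) (Set.Iio 0) isOpen_Iio) 0 0 u p →
      HasWeakSpatialGradientOn (slab (EuclideanSpace ℝ (Fin 3)) (Set.Iio 0) isOpen_Iio) u H →
      (∀ a : ℝ, 0 < a → ENNReal.ofReal (a ^ (2 * ρ)) * cknA a (0 : ℝ × EuclideanSpace ℝ (Fin 3)) u +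
        ENNReal.ofReal (a ^ ρ) * cknE a (0 : ℝ × EuclideanSpace ℝ (Fin 3)) H +
        ENNReal.ofReal (a ^ (2 * ρ)) * cknD a (0 : ℝ × EuclideanSpace ℝ (Fin 3)) p ≤ (c : ℝ≥0∞)) →
      IsClassicalNSSolutionOn (Set.Iio 0) 0 0 u p →
      (∀ τ : ℝ, τ < 0 → IsAxisymmetric (u τ) ∧ HasNoSwirl (u τ)) →
      1 < l →
      (∀ τ : ℝ, τ < 0 → ∀ y, u τ y = (l ^ (1 + ρ)) • u ((l ^ (2 + ρ)) * τ) (l • y)) →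
      (∀ s t : ℝ, s < t → t < 0 → ∃ B : ℝ, ∀ τ ∈ Set.Icc s t, ∀ y,
        ‖u τ y‖ ≤ B ∧ ‖fderiv ℝ (u τ) y‖ ≤ B) →
      1 ≤ m →
      (∀ s t : ℝ, s < t → t < 0 → ∃ N : ℝ, ∀ τ ∈ Set.Icc s t,
        Integrable (fun y => (angVortQuot (u τ) y ^ m) ^ 2) ∧ ∫ y, (angVortQuot (u τ) y ^ m) ^ 2 ≤ N) →
      Function.uncurry u =ᵐ[volume.restrict (Set.Iio (0 : ℝ) ×ˢ (Set.univ : Set (EuclideanSpace ℝ (Fin 3))))] 0 :=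
  fun _ hρ _ _ _ _ _ _ _ hH hc hns hsym hl hdss hbdd hm hLm =>
    ae_eq_zero_of_gauge_of_curl_slice_eq_zero (by linarith) hH hc hns fun τ hτ =>
      curl_slice_eq_zero_of_dss_pow hρ hns (fun σ hσ => (hsym σ hσ).1) (fun σ hσ => (hsym σ hσ).2)
        hl hdss hbdd hm hLm hτ

/-- **The axisymmetric (swirl allowed) DSS stratum with `(r u_θ)^k ∈ L²` (one `k ≥ 1`, `2kρ ≠ 3`) and
`(ω_θ/r)^m ∈ L²` (one `m ≥ 1`)**, every `ρ > 0`. [folklore] -/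
theorem powerGaugeEulerLiouville_axisym_dss_pow :
    ∀ ρ : ℝ, 0 < ρ → ∀ (u : ℝ → EuclideanSpace ℝ (Fin 3) → EuclideanSpace ℝ (Fin 3))
      (p : ℝ → EuclideanSpace ℝ (Fin 3) → ℝ)
      (H : ℝ → EuclideanSpace ℝ (Fin 3) → EuclideanSpace ℝ (Fin 3) →L[ℝ] EuclideanSpace ℝ (Fin 3)) (c : ℝ≥0)
      (l : ℝ) (k m : ℕ),
      IsSuitableWeakSolutionOn (slab (EuclideanSpace ℝ (Fin 3)) (Set.Iio 0) isOpen_Iio) 0 0 u p →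
      HasWeakSpatialGradientOn (slab (EuclideanSpace ℝ (Fin 3)) (Set.Iio 0) isOpen_Iio) u H →
      (∀ a : ℝ, 0 < a → ENNReal.ofReal (a ^ (2 * ρ)) * cknA a (0 : ℝ × EuclideanSpace ℝ (Fin 3)) u +
        ENNReal.ofReal (a ^ ρ) * cknE a (0 : ℝ × EuclideanSpace ℝ (Fin 3)) H +
        ENNReal.ofReal (a ^ (2 * ρ)) * cknD a (0 : ℝ × EuclideanSpace ℝ (Fin 3)) p ≤ (c : ℝ≥0∞)) →
      IsClassicalNSSolutionOn (Set.Iio 0) 0 0 u p →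
      (∀ τ : ℝ, τ < 0 → IsAxisymmetric (u τ)) →
      1 < l →
      (∀ τ : ℝ, τ < 0 → ∀ y, u τ y = (l ^ (1 + ρ)) • u ((l ^ (2 + ρ)) * τ) (l • y)) →
      (∀ s t : ℝ, s < t → t < 0 → ∃ B : ℝ, ∀ τ ∈ Set.Icc s t, ∀ y,
        ‖u τ y‖ ≤ B ∧ ‖fderiv ℝ (u τ) y‖ ≤ B) →
      1 ≤ k → 2 * (k : ℝ) * ρ ≠ 3 →
      (∀ s t : ℝ, s < t → t < 0 → ∃ N : ℝ, ∀ τ ∈ Set.Icc s t,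
        Integrable (fun y => (swirl (u τ) y ^ k) ^ 2) ∧ ∫ y, (swirl (u τ) y ^ k) ^ 2 ≤ N) →
      1 ≤ m →
      (∀ s t : ℝ, s < t → t < 0 → ∃ N : ℝ, ∀ τ ∈ Set.Icc s t,
        Integrable (fun y => (angVortQuot (u τ) y ^ m) ^ 2) ∧ ∫ y, (angVortQuot (u τ) y ^ m) ^ 2 ≤ N) →
      Function.uncurry u =ᵐ[volume.restrict (Set.Iio (0 : ℝ) ×ˢ (Set.univ : Set (EuclideanSpace ℝ (Fin 3))))] 0 := by
  intro ρ hρ u p H c l k m _ hH hc hns hax hl hdss hbdd hk1 hk hLk hm hLm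
  have hsw : ∀ τ : ℝ, τ < 0 → HasNoSwirl (u τ) := fun τ hτ =>
    swirl_slice_eq_zero_of_dss hρ hns hax hl hdss hbdd hk1 hk hLk hτ
  exact ae_eq_zero_of_gauge_of_curl_slice_eq_zero (by linarith) hH hc hns fun τ hτ =>
    curl_slice_eq_zero_of_dss_pow hρ hns hax hsw hl hdss hbdd hm hLm hτ

end Summit.NavierStokesRegularity.NavierStokesRegularity.Theorems.PowerGaugeEulerLiouville.AxisymNoSwirl

end
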